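import Summits.Schanuel.Schanuel.Theorems.SoloInformedX193Supply

/-!
# X193 kernel line, file F7b': the supply side of the count, summed over the lives

Solo seat `solo-Schanuel-informed`, X193 kernel programme (design note
`work/s213/X193-KERNEL-DESIGN.md`, Amendments A4-A7; pen proof `work/s194/X193-pen.md` §5
Corollary and §7; files F7a = `SoloInformedX193Lives`, F7b = `SoloInformedX193Supply`,
F7c = `SoloInformedX193Demand`).

For every listed life `(P, e)` of a cheap capped main server on a window of levels `W`
(file F7a `lives`), the levels it serves have harmonic mass
`Σ 1/n ≤ 3 + β + 2 b₁ + (B + δ) log M` (`life_harmonic_le`: the window of file F7b and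
the harmonic toolkit of file F7c), its per-level supply `2 C_P(e-1)/(e-1)^ν` converts into
the lifetime payment, `≤ 2^{1+β} M^δ (g_P/e + L_P/e^β)` (`cost_conversion`,
`life_supply_le`), and with the regrouping, exchange and payment bounds of file F7a:
`Σ_{n ∈ W} |G n| / n ≤ (3 + β + 2b₁ + (B+δ) log M) · 2^{1+β} M^δ · (κ^{β+1}/θ) ·
(2 + b₁) (1/(E₀+1) + log (N₁/(E₀+1)))` (`supply_le`).  No definitions, no sorries.
-/

namespace Summit.Schanuel.Schanuel.Theorems

namespace SoloServiceData

variable {ι : Type*} (D : SoloServiceData ι)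

/-! ### Cost to payment -/

/-- COST → PAYMENT conversion (pen §5 Cor (iv) with §7: "`s^H_P ≤ (1+o) Π_P/(γ'' c_{N₁})`"):
for `1 ≤ ℓ ≤ M`, `β ≥ 1`, `δ ≥ 0`, `ν + δ = 1 + β`,
`2 C_P(ℓ) / ℓ^ν ≤ 2^{1+β} M^δ (g_P / (ℓ+1) + L_P / (ℓ+1)^β)`
(`C_P(ℓ) / ℓ^ν = ℓ^δ (g_P/ℓ + L_P/ℓ^β)` and `ℓ + 1 ≤ 2ℓ`). -/
theorem cost_conversion {c₀ : ℝ} (hW : D ∈ wellFormed c₀) {β ν δ : ℝ} (hβ : 1 ≤ β)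
    (hδ : 0 ≤ δ) (hνδ : ν + δ = 1 + β) (P : ι) {ℓ : ℕ} (hℓ1 : 1 ≤ ℓ) {M : ℝ}
    (hℓM : (ℓ : ℝ) ≤ M) :
    2 * D.cost β P ℓ / (ℓ : ℝ) ^ ν ≤
      2 ^ (1 + β) * M ^ δ *
        ((D.deg P : ℝ) / ((ℓ : ℝ) + 1) + D.logHt P / ((ℓ : ℝ) + 1) ^ β) := by
  set g : ℝ := (D.deg P : ℝ) with hgdef
  set L : ℝ := D.logHt P with hLdef
  set a : ℝ := (ℓ : ℝ) ^ β with hadef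
  set c : ℝ := (2 : ℝ) ^ β with hcdef
  have hg : 0 ≤ g := by positivity
  have hL : 0 ≤ L := hW.2.1 P
  have hℓpos : (0 : ℝ) < ℓ := by exact_mod_cast hℓ1
  have hℓ1' : (1 : ℝ) ≤ ℓ := by exact_mod_cast hℓ1
  have ha : 0 < a := Real.rpow_pos_of_pos hℓpos β
  have hc2 : 2 ≤ c := by
    have := Real.rpow_le_rpow_of_exponent_le (by norm_num : (1 : ℝ) ≤ 2) hβ
    rwa [Real.rpow_one] at this
  have hc : 0 < c := by linarith
  have h2c : (2 : ℝ) ^ (1 + β) = 2 * c := by rw [Real.rpow_add two_pos, Real.rpow_one]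
  have hℓa : (ℓ : ℝ) ^ δ * (ℓ : ℝ) ^ ν = ℓ * a := by
    rw [← Real.rpow_add hℓpos, show δ + ν = β + 1 by linarith, Real.rpow_add_one hℓpos.ne',
      hadef, mul_comm]
  have hd : (ℓ : ℝ) + 1 ≤ c * ℓ := by nlinarith
  have hp : ((ℓ : ℝ) + 1) ^ β ≤ c * a := by
    rw [hcdef, hadef, ← Real.mul_rpow (by norm_num) hℓpos.le]
    exact Real.rpow_le_rpow (by positivity) (by linarith) (by linarith)
  have hcℓ : c * ℓ ≠ 0 := (mul_pos hc hℓpos).ne'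
  have hca : c * a ≠ 0 := (mul_pos hc ha).ne'
  have T1 : 2 * g * a ≤ 2 * c * ℓ * a * (g / ((ℓ : ℝ) + 1)) := by
    have q : g / (c * ℓ) ≤ g / ((ℓ : ℝ) + 1) :=
      div_le_div_of_nonneg_left hg (by positivity) hd
    have i1 : 2 * c * ℓ * a * (g / (c * ℓ)) = 2 * g * a := by
      rw [mul_div_assoc', show 2 * c * ℓ * a * g = 2 * g * a * (c * ℓ) by ring]
      exact mul_div_cancel_right₀ _ hcℓ
    calc 2 * g * a = 2 * c * ℓ * a * (g / (c * ℓ)) := i1.symm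
      _ ≤ 2 * c * ℓ * a * (g / ((ℓ : ℝ) + 1)) :=
          mul_le_mul_of_nonneg_left q (by positivity)
  have T2 : 2 * L * ℓ ≤ 2 * c * ℓ * a * (L / ((ℓ : ℝ) + 1) ^ β) := by
    have q : L / (c * a) ≤ L / ((ℓ : ℝ) + 1) ^ β :=
      div_le_div_of_nonneg_left hL (Real.rpow_pos_of_pos (by positivity) β) hp
    have i2 : 2 * c * ℓ * a * (L / (c * a)) = 2 * L * ℓ := by
      rw [mul_div_assoc', show 2 * c * ℓ * a * L = 2 * L * ℓ * (c * a) by ring]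
      exact mul_div_cancel_right₀ _ hca
    calc 2 * L * ℓ = 2 * c * ℓ * a * (L / (c * a)) := i2.symm
      _ ≤ 2 * c * ℓ * a * (L / ((ℓ : ℝ) + 1) ^ β) :=
          mul_le_mul_of_nonneg_left q (by positivity)
  have key : 2 * D.cost β P ℓ ≤ 2 ^ (1 + β) * ((ℓ : ℝ) ^ δ * (ℓ : ℝ) ^ ν) *
      (g / ((ℓ : ℝ) + 1) + L / ((ℓ : ℝ) + 1) ^ β) := by
    have e0 : 2 * D.cost β P ℓ = 2 * g * a + 2 * L * ℓ := by
      rw [hgdef, hLdef, hadef]; unfold cost; ring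
    rw [e0, h2c, hℓa]
    linarith
  have hX : 0 ≤ g / ((ℓ : ℝ) + 1) + L / ((ℓ : ℝ) + 1) ^ β :=
    add_nonneg (div_nonneg hg (by positivity)) (div_nonneg hL (by positivity))
  have hMδ : (ℓ : ℝ) ^ δ ≤ M ^ δ := Real.rpow_le_rpow hℓpos.le hℓM hδ
  have hℓν : (0 : ℝ) < (ℓ : ℝ) ^ ν := Real.rpow_pos_of_pos hℓpos ν
  have h2pos : (0 : ℝ) ≤ 2 ^ (1 + β) := (Real.rpow_pos_of_pos two_pos _).le
  rw [div_le_iff₀ hℓν]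
  have h5 : 2 ^ (1 + β) * ((ℓ : ℝ) ^ δ * (ℓ : ℝ) ^ ν) *
      (g / ((ℓ : ℝ) + 1) + L / ((ℓ : ℝ) + 1) ^ β) ≤
      2 ^ (1 + β) * (M ^ δ * (ℓ : ℝ) ^ ν) * (g / ((ℓ : ℝ) + 1) + L / ((ℓ : ℝ) + 1) ^ β) :=
    mul_le_mul_of_nonneg_right
      (mul_le_mul_of_nonneg_left (mul_le_mul_of_nonneg_right hMδ hℓν.le) h2pos) hX
  calc 2 * D.cost β P ℓ ≤ _ := key
    _ ≤ _ := h5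
    _ = 2 ^ (1 + β) * M ^ δ * (g / ((ℓ : ℝ) + 1) + L / ((ℓ : ℝ) + 1) ^ β) * (ℓ : ℝ) ^ ν := by
        ring

section Lives

variable [DecidableEq ι]

/-! ### The harmonic mass of a cheap life and the supply bound -/

/-- HARMONIC MASS OF A LIFE (pen §5 Cor (i): "`W_P ≤ W_max`"): on a window of levels `W`
(all `≥ n₀`, with `n + 2 ≤ M` and the entry inequality of `good_entry`) with good columns
`G n ⊆ [1, K]` served by `srv n`, every listed life `(P, e)` serves on levels of total
harmonic mass `Σ_{n ∈ lifeLevels} 1/n ≤ 3 + β + 2 b₁ + (B + δ) log M` (`ν + δ = 1 + β`):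
the levels lie in `[ℓ, 2η U(e) / (λ ℓ^{ν-1})]`, `ℓ = e - 1`, then
`soloX_harmonic_le_of_bounds` (file F7c), `soloX_window_ratio_le`, `soloX_log_ratio_le`. -/
theorem life_harmonic_le {c₀ β b₁ σ ν A₂ : ℝ} {n₀ : ℕ} (hW : D ∈ wellFormed c₀)
    (hB : D ∈ budgetLaw β b₁ n₀) (hE : D ∈ entryLaw β σ ν A₂ n₀) (hb₁ : 0 ≤ b₁)
    (hβ : 1 ≤ β) (hA₂ : 0 ≤ A₂) (hσ : 0 < σ) (hσ1 : σ ≤ 1) {B : ℝ} (hBnn : 0 ≤ B)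
    {lam η : ℝ} (hη : 0 ≤ η) (h2η : 2 * η < lam) {δ : ℝ} (hδ : 0 ≤ δ)
    (hνδ : ν + δ = 1 + β) {E₀ : ℕ} (hE₀ : n₀ ≤ E₀) (hE₁ : 1 ≤ E₀)
    (habs : ∀ ℓ : ℕ, E₀ ≤ ℓ → 16 * A₂ * (ℓ : ℝ) ^ (2 - β) * Real.log ((ℓ : ℝ) + 2) ≤ 1)
    {K : ℕ} (hK : (K : ℝ) ≤ (E₀ : ℝ) ^ σ) {W : Finset ℕ} (hW0 : ∀ n ∈ W, n₀ ≤ n) {M : ℝ}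
    (hWM : ∀ n ∈ W, (n : ℝ) + 2 ≤ M)
    (hbig : ∀ n ∈ W, 2 * n * ((E₀ : ℝ) ^ β + b₁ * E₀) +
      B * (n : ℝ) ^ 2 * Real.log ((n : ℝ) + 2) < lam * (n : ℝ) ^ ν)
    {G : ℕ → Finset ℕ} (hGK : ∀ n ∈ W, G n ⊆ Finset.Icc 1 K) {srv : ℕ → ℕ → ι}
    (hgood : ∀ n ∈ W, ∀ k ∈ G n, srv n k ∈ D.alive n ∧
      lam * (n : ℝ) ^ ν ≤ D.mult (srv n k) n * D.bank (srv n k) k ∧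
      D.bank (srv n k) k ≤ D.cap B (srv n k) n ∧
      (D.mult (srv n k) n : ℝ) * D.cost β (srv n k) n ≤
        η * (n : ℝ) ^ ν * ((G n).filter (fun k' => srv n k' = srv n k)).card)
    {pe : ι × ℕ} (hpe : pe ∈ D.lives W (fun n => (G n).image (srv n))) :
    ∑ n ∈ D.lifeLevels W (fun n => (G n).image (srv n)) pe.1 pe.2, 1 / (n : ℝ) ≤
      3 + β + 2 * b₁ + (B + δ) * Real.log M := by
  have hlam : 0 < lam := by linarith
  have hβ0 : 0 ≤ β := le_trans zero_le_one hβ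
  -- the levels of the life: entry facts and the lower side of the window
  have key : ∀ n ∈ W, pe.1 ∈ (G n).image (srv n) → D.entry pe.1 n = pe.2 →
      E₀ + 1 ≤ pe.2 ∧ pe.2 ≤ n ∧
      lam * n * (((pe.2 - 1 : ℕ) : ℝ)) ^ (ν - 1) ≤
        2 * η * (2 * ((((pe.2 - 1 : ℕ) : ℝ)) + 1) *
          (((((pe.2 - 1 : ℕ) : ℝ)) + 1) ^ β + b₁ * ((((pe.2 - 1 : ℕ) : ℝ)) + 1)) +
          B * ((((pe.2 - 1 : ℕ) : ℝ)) + 1) ^ 2 * Real.log M) := by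
    intro n hn hP he
    obtain ⟨k, hk, hPk⟩ := Finset.mem_image.mp hP
    have hek : D.entry (srv n k) n = pe.2 := by rw [hPk]; exact he
    obtain ⟨hP', hsup, hcap, -⟩ := hgood n hn k hk
    obtain ⟨h1, h2, h3⟩ := D.good_entry hW hB hb₁ hβ0 hBnn hE₀ (hW0 n hn) hP' hsup hcap
      (hbig n hn)
    have hwl := D.good_window_lower hW hB hE hb₁ hβ hA₂ hσ hσ1 hBnn hη h2η hE₀ hE₁ habs hK
      (hW0 n hn) (hWM n hn) (hbig n hn) (hGK n hn) (hgood n hn) hk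
    rw [hek] at h1 h2 h3 hwl
    exact ⟨by omega, h3, hwl⟩
  obtain ⟨n₁, hn₁, hP₁, he₁⟩ := D.mem_lives.mp hpe
  obtain ⟨hE₀e, hen₁, -⟩ := key n₁ hn₁ hP₁ he₁
  obtain ⟨ℓ, hℓe⟩ : ∃ ℓ : ℕ, pe.2 = ℓ + 1 := ⟨pe.2 - 1, by omega⟩
  have hsub : pe.2 - 1 = ℓ := by omega
  simp only [hsub] at key
  have hE₀ℓ : E₀ ≤ ℓ := by omega
  have hℓ1 : 1 ≤ ℓ := hE₁.trans hE₀ℓ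
  have hℓpos : (0 : ℝ) < ℓ := by exact_mod_cast hℓ1
  have hℓ1' : (1 : ℝ) ≤ ℓ := by exact_mod_cast hℓ1
  have hℓn₁ : (ℓ : ℝ) + 1 ≤ n₁ := by
    have : ((ℓ + 1 : ℕ) : ℝ) ≤ n₁ := by exact_mod_cast hℓe ▸ hen₁
    push_cast at this
    exact this
  have hM1 : 1 ≤ M := by linarith [hWM n₁ hn₁]
  have hℓM : (ℓ : ℝ) ≤ M := by linarith [hWM n₁ hn₁]
  set U : ℝ := 2 * ((ℓ : ℝ) + 1) * (((ℓ : ℝ) + 1) ^ β + b₁ * ((ℓ : ℝ) + 1)) +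
    B * ((ℓ : ℝ) + 1) ^ 2 * Real.log M with hU
  have hUpos : 0 < U := soloX_capBound_pos hb₁ hBnn hM1 (by linarith : (1 : ℝ) ≤ ℓ + 1)
  have hpow : (0 : ℝ) < (ℓ : ℝ) ^ (ν - 1) := Real.rpow_pos_of_pos hℓpos _
  set y : ℝ := 2 * η * U / (lam * (ℓ : ℝ) ^ (ν - 1)) with hy
  have hlev : ∀ n ∈ D.lifeLevels W (fun n => (G n).image (srv n)) pe.1 pe.2,
      (ℓ : ℝ) ≤ n ∧ (n : ℝ) ≤ y := by
    intro n hn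
    obtain ⟨hnW, hP, he⟩ := D.mem_lifeLevels.mp hn
    obtain ⟨-, hen, hwl⟩ := key n hnW hP he
    refine ⟨?_, ?_⟩
    · have : ((ℓ + 1 : ℕ) : ℝ) ≤ n := by exact_mod_cast hℓe ▸ hen
      push_cast at this
      linarith
    · rw [hy, le_div_iff₀ (mul_pos hlam hpow)]
      linarith
  have hxy : (ℓ : ℝ) ≤ y := by
    obtain ⟨h1, h2⟩ := hlev n₁ (D.mem_lifeLevels.mpr ⟨hn₁, hP₁, he₁⟩)
    exact h1.trans h2
  have hsum := soloX_harmonic_le_of_bounds _ hℓpos hxy hlev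
  have hR := soloX_window_ratio_le hβ hb₁ hBnn hδ hνδ hℓ1' hℓM
  have hlogR := soloX_log_ratio_le (δ := δ) hβ0 hb₁ hBnn hM1
  have h1 : 1 / (ℓ : ℝ) ≤ 1 := by rw [div_le_one hℓpos]; exact hℓ1'
  have hyR : y / ℓ ≤ (2 + 2 * b₁ + B * Real.log M) * 2 ^ (1 + β) * M ^ δ := by
    have hℓν : (0 : ℝ) < (ℓ : ℝ) ^ ν := Real.rpow_pos_of_pos hℓpos ν
    have hUle : U ≤ (2 + 2 * b₁ + B * Real.log M) * 2 ^ (1 + β) * M ^ δ * (ℓ : ℝ) ^ ν :=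
      (div_le_iff₀ hℓν).mp hR
    have eℓ : (ℓ : ℝ) ^ ν = (ℓ : ℝ) ^ (ν - 1) * ℓ := by
      rw [← Real.rpow_add_one hℓpos.ne', sub_add_cancel]
    rw [eℓ] at hUle
    rw [div_le_iff₀ hℓpos, hy, div_le_iff₀ (mul_pos hlam hpow)]
    have i1 : 2 * η * U ≤ lam * U := mul_le_mul_of_nonneg_right h2η.le hUpos.le
    have i2 : lam * U ≤ lam * ((2 + 2 * b₁ + B * Real.log M) * 2 ^ (1 + β) * M ^ δ *
        ((ℓ : ℝ) ^ (ν - 1) * ℓ)) := mul_le_mul_of_nonneg_left hUle hlam.le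
    linarith
  have hypos : 0 < y / ℓ := div_pos (lt_of_lt_of_le hℓpos hxy) hℓpos
  have hlog : Real.log (y / ℓ) ≤
      Real.log ((2 + 2 * b₁ + B * Real.log M) * 2 ^ (1 + β) * M ^ δ) :=
    Real.log_le_log hypos hyR
  linarith [hsum, h1, hlog, hlogR]

/-- The supply term of one listed life (pen §5 Cor (iii)-(iv)): with `s(P, e) =
2 C_P(e-1) / (e-1)^ν` (the per-level fibre bound of `good_server`) and the harmonic mass
of `life_harmonic_le`, `s(P, e) · Σ_{levels} 1/n ≤
(3 + β + 2b₁ + (B+δ) log M) · 2^{1+β} M^δ · (g_P / e + L_P / e^β)` (`cost_conversion`). -/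
theorem life_supply_le {c₀ β b₁ σ ν A₂ : ℝ} {n₀ : ℕ} (hW : D ∈ wellFormed c₀)
    (hB : D ∈ budgetLaw β b₁ n₀) (hE : D ∈ entryLaw β σ ν A₂ n₀) (hb₁ : 0 ≤ b₁)
    (hβ : 1 ≤ β) (hA₂ : 0 ≤ A₂) (hσ : 0 < σ) (hσ1 : σ ≤ 1) {B : ℝ} (hBnn : 0 ≤ B)
    {lam η : ℝ} (hη : 0 ≤ η) (h2η : 2 * η < lam) {δ : ℝ} (hδ : 0 ≤ δ)
    (hνδ : ν + δ = 1 + β) {E₀ : ℕ} (hE₀ : n₀ ≤ E₀) (hE₁ : 1 ≤ E₀)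
    (habs : ∀ ℓ : ℕ, E₀ ≤ ℓ → 16 * A₂ * (ℓ : ℝ) ^ (2 - β) * Real.log ((ℓ : ℝ) + 2) ≤ 1)
    {K : ℕ} (hK : (K : ℝ) ≤ (E₀ : ℝ) ^ σ) {W : Finset ℕ} (hW0 : ∀ n ∈ W, n₀ ≤ n) {M : ℝ}
    (hWM : ∀ n ∈ W, (n : ℝ) + 2 ≤ M)
    (hbig : ∀ n ∈ W, 2 * n * ((E₀ : ℝ) ^ β + b₁ * E₀) +
      B * (n : ℝ) ^ 2 * Real.log ((n : ℝ) + 2) < lam * (n : ℝ) ^ ν)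
    {G : ℕ → Finset ℕ} (hGK : ∀ n ∈ W, G n ⊆ Finset.Icc 1 K) {srv : ℕ → ℕ → ι}
    (hgood : ∀ n ∈ W, ∀ k ∈ G n, srv n k ∈ D.alive n ∧
      lam * (n : ℝ) ^ ν ≤ D.mult (srv n k) n * D.bank (srv n k) k ∧
      D.bank (srv n k) k ≤ D.cap B (srv n k) n ∧
      (D.mult (srv n k) n : ℝ) * D.cost β (srv n k) n ≤
        η * (n : ℝ) ^ ν * ((G n).filter (fun k' => srv n k' = srv n k)).card)
    {pe : ι × ℕ} (hpe : pe ∈ D.lives W (fun n => (G n).image (srv n))) :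
    2 * D.cost β pe.1 (pe.2 - 1) / (((pe.2 - 1 : ℕ) : ℝ)) ^ ν *
        ∑ n ∈ D.lifeLevels W (fun n => (G n).image (srv n)) pe.1 pe.2, 1 / (n : ℝ) ≤
      (3 + β + 2 * b₁ + (B + δ) * Real.log M) * (2 ^ (1 + β) * M ^ δ) *
        ((D.deg pe.1 : ℝ) / pe.2 + D.logHt pe.1 / (pe.2 : ℝ) ^ β) := by
  have hβ0 : 0 ≤ β := le_trans zero_le_one hβ
  have hH := D.life_harmonic_le hW hB hE hb₁ hβ hA₂ hσ hσ1 hBnn hη h2η hδ hνδ hE₀ hE₁ habs hK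
    hW0 hWM hbig hGK hgood hpe
  obtain ⟨n, hn, hP, he⟩ := D.mem_lives.mp hpe
  obtain ⟨k, hk, hPk⟩ := Finset.mem_image.mp hP
  obtain ⟨hP', hsup, hcap, -⟩ := hgood n hn k hk
  obtain ⟨h1, h2, h3⟩ := D.good_entry hW hB hb₁ hβ0 hBnn hE₀ (hW0 n hn) hP' hsup hcap
    (hbig n hn)
  have hek : D.entry (srv n k) n = pe.2 := by rw [hPk]; exact he
  rw [hek] at h1 h2 h3
  obtain ⟨ℓ, hℓe⟩ : ∃ ℓ : ℕ, pe.2 = ℓ + 1 := ⟨pe.2 - 1, by omega⟩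
  have hsub : pe.2 - 1 = ℓ := by omega
  rw [hℓe] at hH
  rw [hsub, hℓe]
  push_cast
  have hE₀ℓ : E₀ ≤ ℓ := by omega
  have hℓ1 : 1 ≤ ℓ := hE₁.trans hE₀ℓ
  have hℓM : (ℓ : ℝ) ≤ M := by
    have : ((ℓ + 1 : ℕ) : ℝ) ≤ n := by exact_mod_cast hℓe ▸ h3
    push_cast at this
    linarith [hWM n hn]
  have hM1 : 1 ≤ M := le_trans (by exact_mod_cast hℓ1) hℓM
  have hconv := D.cost_conversion hW hβ hδ hνδ pe.1 hℓ1 hℓM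
  have hs0 : 0 ≤ 2 * D.cost β pe.1 ℓ / (ℓ : ℝ) ^ ν :=
    div_nonneg (mul_nonneg zero_le_two
      (le_trans (Real.rpow_nonneg (Nat.cast_nonneg ℓ) β) (D.rpow_le_cost hW β pe.1 ℓ)))
      (Real.rpow_nonneg (Nat.cast_nonneg ℓ) ν)
  have hHmax : 0 ≤ 3 + β + 2 * b₁ + (B + δ) * Real.log M := by
    have := mul_nonneg (add_nonneg hBnn hδ) (Real.log_nonneg hM1)
    linarith
  refine le_trans (mul_le_mul_of_nonneg_left hH hs0) ?_
  refine le_trans (mul_le_mul_of_nonneg_right hconv hHmax) (le_of_eq ?_)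
  ring

/-- SUPPLY BOUND of pen §7 assembled: on a window of levels `W ⊆ [n₀, N₁]` (`n + 2 ≤ M`,
entry inequality of `good_entry`) with good columns `G n ⊆ [1, K]`, `K ≤ E₀^σ`, served by
cheap capped main servers `srv n`, and a payment window `[e, V e]` (`θ e ≤ V e + 1 - e`,
`V e ≤ κ e` for `e > E₀`) lying below every witnessing level,
`Σ_{n ∈ W} |G n| / n ≤ (3 + β + 2b₁ + (B+δ) log M) · 2^{1+β} M^δ · (κ^{β+1}/θ) ·
(2 + b₁) (1/(E₀+1) + log (N₁/(E₀+1)))`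
(`supply_regroup`, `life_supply_le`, `lives_cost_le_harmonic`, `soloX_level_sum_le`). -/
theorem supply_le {c₀ β b₁ σ ν A₂ : ℝ} {n₀ : ℕ} (hW : D ∈ wellFormed c₀)
    (hB : D ∈ budgetLaw β b₁ n₀) (hE : D ∈ entryLaw β σ ν A₂ n₀) (hb₁ : 0 ≤ b₁)
    (hβ : 1 ≤ β) (hA₂ : 0 ≤ A₂) (hσ : 0 < σ) (hσ1 : σ ≤ 1) {B : ℝ} (hBnn : 0 ≤ B)
    {lam η : ℝ} (hη : 0 ≤ η) (h2η : 2 * η < lam) {δ : ℝ} (hδ : 0 ≤ δ)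
    (hνδ : ν + δ = 1 + β) {θ κ : ℝ} (hθ : 0 < θ) (hκ : 1 ≤ κ) {E₀ N₁ : ℕ} (hE₀ : n₀ ≤ E₀)
    (hE₁ : 1 ≤ E₀) (hEN : E₀ + 1 ≤ N₁)
    (habs : ∀ ℓ : ℕ, E₀ ≤ ℓ → 16 * A₂ * (ℓ : ℝ) ^ (2 - β) * Real.log ((ℓ : ℝ) + 2) ≤ 1)
    {K : ℕ} (hK : (K : ℝ) ≤ (E₀ : ℝ) ^ σ) {W : Finset ℕ} (hW0 : ∀ n ∈ W, n₀ ≤ n)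
    (hWN : ∀ n ∈ W, n ≤ N₁) {M : ℝ} (hM1 : 1 ≤ M) (hWM : ∀ n ∈ W, (n : ℝ) + 2 ≤ M)
    (hbig : ∀ n ∈ W, 2 * n * ((E₀ : ℝ) ^ β + b₁ * E₀) +
      B * (n : ℝ) ^ 2 * Real.log ((n : ℝ) + 2) < lam * (n : ℝ) ^ ν)
    {G : ℕ → Finset ℕ} (hGK : ∀ n ∈ W, G n ⊆ Finset.Icc 1 K) {srv : ℕ → ℕ → ι}
    (hgood : ∀ n ∈ W, ∀ k ∈ G n, srv n k ∈ D.alive n ∧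
      lam * (n : ℝ) ^ ν ≤ D.mult (srv n k) n * D.bank (srv n k) k ∧
      D.bank (srv n k) k ≤ D.cap B (srv n k) n ∧
      (D.mult (srv n k) n : ℝ) * D.cost β (srv n k) n ≤
        η * (n : ℝ) ^ ν * ((G n).filter (fun k' => srv n k' = srv n k)).card)
    {V : ℕ → ℕ} (hVwit : ∀ n ∈ W, ∀ k ∈ G n, V (D.entry (srv n k) n) ≤ n)
    (hVwin : ∀ e : ℕ, E₀ + 1 ≤ e →
      e ≤ V e ∧ θ * (e : ℝ) ≤ (V e : ℝ) + 1 - e ∧ (V e : ℝ) ≤ κ * e) :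
    ∑ n ∈ W, ((G n).card : ℝ) / n ≤
      (3 + β + 2 * b₁ + (B + δ) * Real.log M) * (2 ^ (1 + β) * M ^ δ) *
        (κ ^ (β + 1) / θ) *
        ((2 + b₁) * (1 / ((E₀ + 1 : ℕ) : ℝ) + Real.log ((N₁ : ℝ) / ((E₀ + 1 : ℕ) : ℝ)))) := by
  have hβ0 : 0 ≤ β := le_trans zero_le_one hβ
  have hM0 : 0 < M := by linarith
  have hHmax : 0 ≤ 3 + β + 2 * b₁ + (B + δ) * Real.log M := by
    have := mul_nonneg (add_nonneg hBnn hδ) (Real.log_nonneg hM1)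
    linarith
  have hC : 0 ≤ (2 : ℝ) ^ (1 + β) * M ^ δ :=
    (mul_pos (Real.rpow_pos_of_pos two_pos _) (Real.rpow_pos_of_pos hM0 _)).le
  have hκpow : 0 < κ ^ (β + 1) := Real.rpow_pos_of_pos (by linarith) _
  set Cf : ℝ := (3 + β + 2 * b₁ + (B + δ) * Real.log M) * (2 ^ (1 + β) * M ^ δ) *
    (κ ^ (β + 1) / θ) with hCf
  have hCf0 : 0 ≤ Cf := mul_nonneg (mul_nonneg hHmax hC) (div_pos hκpow hθ).le
  have hunit : κ ^ (β + 1) / θ * (θ / κ ^ (β + 1)) = 1 := by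
    rw [div_mul_div_comm, mul_comm θ, div_self (mul_pos hκpow hθ).ne']
  -- the servers of the good columns, level by level
  have hsrv : ∀ n ∈ W, ∀ k ∈ G n,
      E₀ ≤ D.entry (srv n k) n - 1 ∧
      D.entry (srv n k) n = (D.entry (srv n k) n - 1) + 1 ∧ D.entry (srv n k) n ≤ n ∧
      (((G n).filter (fun k' => srv n k' = srv n k)).card : ℝ) *
          ((D.entry (srv n k) n - 1 : ℕ) : ℝ) ^ ν ≤
        2 * D.cost β (srv n k) (D.entry (srv n k) n - 1) :=
    fun n hn k hk => D.good_server hW hB hE hb₁ hβ0 hA₂ hσ hσ1 hBnn h2η hE₀ hE₁ habs hK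
      (hW0 n hn) (hbig n hn) (hGK n hn) (hgood n hn) hk
  -- (1) regroup the incidences by lives, with the per-level fibre bound
  have hs : ∀ n ∈ W, ∀ P ∈ (G n).image (srv n),
      (((G n).filter (fun k => srv n k = P)).card : ℝ) ≤
        2 * D.cost β P (D.entry P n - 1) / (((D.entry P n - 1 : ℕ) : ℝ)) ^ ν := by
    intro n hn P hP
    obtain ⟨k, hk, rfl⟩ := Finset.mem_image.mp hP
    obtain ⟨h1, -, -, h4⟩ := hsrv n hn k hk
    have hpos : (0 : ℝ) < (((D.entry (srv n k) n - 1 : ℕ) : ℝ)) ^ ν :=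
      Real.rpow_pos_of_pos (by exact_mod_cast lt_of_lt_of_le (by omega : 0 < E₀) h1) ν
    rw [le_div_iff₀ hpos]
    exact h4
  have step1 := D.supply_regroup W G srv
    (fun P e => 2 * D.cost β P (e - 1) / (((e - 1 : ℕ) : ℝ)) ^ ν) hs
  -- (2) the supply term of each life against its lifetime payment
  have step2 : ∑ pe ∈ D.lives W (fun n => (G n).image (srv n)),
      2 * D.cost β pe.1 (pe.2 - 1) / (((pe.2 - 1 : ℕ) : ℝ)) ^ ν *
        ∑ n ∈ D.lifeLevels W (fun n => (G n).image (srv n)) pe.1 pe.2, 1 / (n : ℝ) ≤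
      ∑ pe ∈ D.lives W (fun n => (G n).image (srv n)),
        Cf * (θ / κ ^ (β + 1) *
          ((D.deg pe.1 : ℝ) / pe.2 + D.logHt pe.1 / (pe.2 : ℝ) ^ β)) := by
    apply Finset.sum_le_sum
    intro pe hpe
    have h := D.life_supply_le hW hB hE hb₁ hβ hA₂ hσ hσ1 hBnn hη h2η hδ hνδ hE₀ hE₁ habs hK
      hW0 hWM hbig hGK hgood hpe
    refine h.trans (le_of_eq ?_)
    rw [hCf, show (3 + β + 2 * b₁ + (B + δ) * Real.log M) * (2 ^ (1 + β) * M ^ δ) *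
        (κ ^ (β + 1) / θ) * (θ / κ ^ (β + 1) *
          ((D.deg pe.1 : ℝ) / pe.2 + D.logHt pe.1 / (pe.2 : ℝ) ^ β)) =
        (3 + β + 2 * b₁ + (B + δ) * Real.log M) * (2 ^ (1 + β) * M ^ δ) *
          ((D.deg pe.1 : ℝ) / pe.2 + D.logHt pe.1 / (pe.2 : ℝ) ^ β) *
          (κ ^ (β + 1) / θ * (θ / κ ^ (β + 1))) by ring, hunit, mul_one]
  -- (3) the payment side: exchange + (Bud) (file F7a) and the level sum (file F7c)
  have hlife : ∀ n ∈ W, ∀ P ∈ (fun n => (G n).image (srv n)) n,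
      1 ≤ D.entry P n ∧ D.entry P n ≤ V (D.entry P n) ∧ V (D.entry P n) ≤ n ∧
      θ * (D.entry P n : ℝ) ≤ (V (D.entry P n) : ℝ) + 1 - D.entry P n ∧
      (V (D.entry P n) : ℝ) ≤ κ * D.entry P n := by
    intro n hn P hP
    obtain ⟨k, hk, rfl⟩ := Finset.mem_image.mp hP
    obtain ⟨h1, h2, -, -⟩ := hsrv n hn k hk
    obtain ⟨hv1, hv2, hv3⟩ := hVwin (D.entry (srv n k) n) (by omega)
    exact ⟨by omega, hv1, hVwit n hn k hk, hv2, hv3⟩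
  have hA : ∀ n ∈ W, ∀ P ∈ (fun n => (G n).image (srv n)) n, E₀ + 1 ≤ D.entry P n := by
    intro n hn P hP
    obtain ⟨k, hk, rfl⟩ := Finset.mem_image.mp hP
    obtain ⟨h1, h2, -, -⟩ := hsrv n hn k hk
    omega
  have step3 := D.lives_cost_le_harmonic hW hB hb₁ hβ W (fun n => (G n).image (srv n)) V
    (E₀ + 1) N₁ (by omega) (by omega) hθ.le hκ hlife hA hWN
  have step4 := soloX_level_sum_le (A := E₀ + 1) (Bm := N₁) (by omega) hEN
    (by linarith : (0 : ℝ) ≤ 2 + b₁)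
  calc ∑ n ∈ W, ((G n).card : ℝ) / n ≤ _ := step1
    _ ≤ _ := step2
    _ = Cf * ∑ pe ∈ D.lives W (fun n => (G n).image (srv n)),
          θ / κ ^ (β + 1) * ((D.deg pe.1 : ℝ) / pe.2 + D.logHt pe.1 / (pe.2 : ℝ) ^ β) := by
        rw [← Finset.mul_sum]
    _ ≤ Cf * ∑ ℓ ∈ Finset.Icc (E₀ + 1) N₁, (2 + b₁) / (ℓ : ℝ) :=
        mul_le_mul_of_nonneg_left step3 hCf0
    _ ≤ Cf * ((2 + b₁) *
          (1 / ((E₀ + 1 : ℕ) : ℝ) + Real.log ((N₁ : ℝ) / ((E₀ + 1 : ℕ) : ℝ)))) :=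
        mul_le_mul_of_nonneg_left step4 hCf0

end Lives

end SoloServiceData

end Summit.Schanuel.Schanuel.Theorems
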